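import Mathlib
import HarnessLib
import Summits.Ventures.LatticeQCDFlow.Exactness.SphereDriftLift
import Summits.Ventures.LatticeQCDFlow.Exactness.MomentumRefresh

/-!
# HMC and THMC on a lattice of site spheres — sitewise geodesic drift, site-coupling kicks — are exact

HONEST FRAMING: exact (Metropolis-corrected) sampling algorithms for lattice gauge theory;
figures of merit are autocorrelation/cost numbers at stated couplings and volumes; no
continuum-physics claim.

Venture `LatticeQCDFlow` (cell pub-lqcd), topic `Exactness`; FANOUT row 7 (`s0-cpn-null`: the
S0-D1 rung — 2D CP⁹ on an `L × L` lattice, HMC vs THMC, molecular dynamics of Engel–Schaefer §2.2: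
momenta tangent to EVERY site sphere, the force on a site given by its neighbours, leapfrog with
the exact geodesic site update).  NEW WORK of the cell, composing the tree's `SphereFrameLift.lean`
/ `SphereDriftLift.lean` (one-site Liouville in product form; time reversal of the ambient drift),
row 9's `SplittingIntegrator.lean` (`IsFlipReversible`, `measurePreserving_perm_pow`) and row 7's
`MomentumRefresh.lean` (`hmc_config_exact`, `thmc_config_exact`) over Mathlib
(`measurePreserving_arrowProdEquivProdArrow`, `measurePreserving_pi`, translation invariance of
`Lebesgue^Λ`).  Nothing is cited as a fact.  Printed counterpart, NAMED ONLY: Engel–Schaefer,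
Comput. Phys. Commun. 182 (2011) 2107, §2.2 eqs. (9)–(11).

The lattice phase space is `(Λ → S^{d−1}) × (Λ → ℝ^d)` with reference measure
`uniformSphere^Λ ⊗ Lebesgue^Λ`.  The drift and the flip act SITEWISE (so their measure preservation
and time reversal are the one-site facts transported through `(Λ → S × E) ≃ᵐ (Λ → S) × (Λ → E)`);
the kick `(x, p) ↦ (x, p + δ F x)` COUPLES the sites through an arbitrary measurable force field
`F : (Λ → S) → (Λ → E)` and is still a translation of the momentum fibre over each configuration.

## Content (`m`, `Λ` finite; `E = EuclideanSpace ℝ m`, `S` its unit sphere)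

* `sitewise f`, `sitewise_eq`, `sitewise_comp`, **`measurePreserving_sitewise`** (product maps of
  measure-preserving site maps preserve `σ^Λ ⊗ Lebesgue^Λ`).
* `latticeKick`, **`measurePreserving_latticeKick`** (any measurable site-coupling force, any
  s-finite configuration law); `latticeFlip`, `latticeDrift t = sitewise (ambientDrift t)`,
  `latticeDrift_flip_latticeDrift` (time reversal).
* `latticeKickPerm`, `latticeFlipPerm`, `latticeDriftPerm`, **`latticeLeapfrogPerm`**; flip
  reversibility; **`involutive_latticeProposal`**; **`measurePreserving_latticeProposal`**
  (LIOUVILLE for the lattice leapfrog, `card m ≥ 2`).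
* **`lattice_sphere_hmc_config_exact`**, **`lattice_sphere_thmc_config_exact`** — HMC / THMC on the
  lattice of site spheres is exact (`e^{−S}·uniformSphere^Λ` invariant) for every measurable action
  `S`, kinetic energy `T` with finite non-zero normalisation, force field, step size, trajectory
  length, and (THMC) every field transformation of `(Λ → S)` with positive Jacobian.

* `latticeGaussianWeight_univ_ne_zero_ne_top`, **`lattice_sphere_hmc_gaussian_exact`** — the
  Gaussian kinetic energy `T = Σ_s ‖p_s‖²/2` (the E–S choice), no normalisation hypothesis left.

NOT CLAIMED: the U(1) link variables of the CP(N−1) action as further factors (circles are the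
`d = 2` case of the same construction; mixed dimensions are bookkeeping not done here); the value
of the Gaussian normalisation; ergodicity; anything quantitative.
-/

noncomputable section

namespace Summit.Ventures.LatticeQCDFlow.Exactness

open MeasureTheory Measure Metric Set Real ProbabilityTheory
open scoped ENNReal InnerProductSpace

/-! ## The lattice of site spheres: sitewise drift and flip, site-coupling kicks -/

section Lattice

variable {m : Type*} [Fintype m] [DecidableEq m] {Λ : Type*} [Fintype Λ]

/-- Apply a one-site phase-space map at every site of a lattice configuration
`(x, p) : (Λ → S) × (Λ → E)`. -/
def sitewise (f : (sphere (0 : EuclideanSpace ℝ m) 1) × (EuclideanSpace ℝ m) → (sphere (0 : EuclideanSpace ℝ m) 1) × (EuclideanSpace ℝ m)) (z : (Λ → (sphere (0 : EuclideanSpace ℝ m) 1)) × (Λ → (EuclideanSpace ℝ m))) : (Λ → (sphere (0 : EuclideanSpace ℝ m) 1)) × (Λ → (EuclideanSpace ℝ m)) :=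
  (fun s => (f (z.1 s, z.2 s)).1, fun s => (f (z.1 s, z.2 s)).2)

omit [DecidableEq m] [Fintype Λ] in
/-- `sitewise f` is the product map conjugated by `(Λ → S × E) ≃ (Λ → S) × (Λ → E)`. -/
theorem sitewise_eq (f : (sphere (0 : EuclideanSpace ℝ m) 1) × (EuclideanSpace ℝ m) → (sphere (0 : EuclideanSpace ℝ m) 1) × (EuclideanSpace ℝ m)) :
    (sitewise f : (Λ → (sphere (0 : EuclideanSpace ℝ m) 1)) × (Λ → (EuclideanSpace ℝ m)) → (Λ → (sphere (0 : EuclideanSpace ℝ m) 1)) × (Λ → (EuclideanSpace ℝ m))) =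
      (MeasurableEquiv.arrowProdEquivProdArrow (sphere (0 : EuclideanSpace ℝ m) 1) (EuclideanSpace ℝ m) Λ) ∘ (fun w s => f (w s)) ∘
        (MeasurableEquiv.arrowProdEquivProdArrow (sphere (0 : EuclideanSpace ℝ m) 1) (EuclideanSpace ℝ m) Λ).symm := by
  rfl

omit [DecidableEq m] [Fintype Λ] in
/-- `sitewise` is functorial. -/
theorem sitewise_comp (f g : (sphere (0 : EuclideanSpace ℝ m) 1) × (EuclideanSpace ℝ m) → (sphere (0 : EuclideanSpace ℝ m) 1) × (EuclideanSpace ℝ m)) :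
    (sitewise (f ∘ g) : (Λ → (sphere (0 : EuclideanSpace ℝ m) 1)) × (Λ → (EuclideanSpace ℝ m)) → (Λ → (sphere (0 : EuclideanSpace ℝ m) 1)) × (Λ → (EuclideanSpace ℝ m))) = sitewise f ∘ sitewise g := by
  rfl

omit [DecidableEq m] in
/-- **A sitewise map of measure-preserving site maps preserves the lattice measure
`σ^Λ ⊗ Lebesgue^Λ`.** -/
theorem measurePreserving_sitewise {f : (sphere (0 : EuclideanSpace ℝ m) 1) × (EuclideanSpace ℝ m) → (sphere (0 : EuclideanSpace ℝ m) 1) × (EuclideanSpace ℝ m)} {σ : Measure (sphere (0 : EuclideanSpace ℝ m) 1)} [SigmaFinite σ]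
    (hf : MeasurePreserving f (σ.prod (volume : Measure (EuclideanSpace ℝ m))) (σ.prod (volume : Measure (EuclideanSpace ℝ m)))) :
    MeasurePreserving (sitewise f : (Λ → (sphere (0 : EuclideanSpace ℝ m) 1)) × (Λ → (EuclideanSpace ℝ m)) → (Λ → (sphere (0 : EuclideanSpace ℝ m) 1)) × (Λ → (EuclideanSpace ℝ m)))
      ((Measure.pi fun _ : Λ => σ).prod (Measure.pi fun _ : Λ => (volume : Measure (EuclideanSpace ℝ m))))
      ((Measure.pi fun _ : Λ => σ).prod (Measure.pi fun _ : Λ => (volume : Measure (EuclideanSpace ℝ m)))) := by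
  have hA := measurePreserving_arrowProdEquivProdArrow (sphere (0 : EuclideanSpace ℝ m) 1) (EuclideanSpace ℝ m) Λ (fun _ => σ)
    (fun _ => (volume : Measure (EuclideanSpace ℝ m)))
  have hpi : MeasurePreserving (fun (w : Λ → (sphere (0 : EuclideanSpace ℝ m) 1) × (EuclideanSpace ℝ m)) (s : Λ) => f (w s))
      (Measure.pi fun _ : Λ => σ.prod (volume : Measure (EuclideanSpace ℝ m)))
      (Measure.pi fun _ : Λ => σ.prod (volume : Measure (EuclideanSpace ℝ m))) :=
    measurePreserving_pi _ _ fun _ => hf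
  rw [sitewise_eq]
  exact hA.comp (hpi.comp hA.symm)

/-- The lattice KICK by a site-coupling force field `F` (site `s` feels `F x s`, a function of the
WHOLE configuration `x`): `(x, p) ↦ (x, p + δ F x)`. -/
def latticeKick (F : (Λ → (sphere (0 : EuclideanSpace ℝ m) 1)) → (Λ → (EuclideanSpace ℝ m))) (δ : ℝ) (z : (Λ → (sphere (0 : EuclideanSpace ℝ m) 1)) × (Λ → (EuclideanSpace ℝ m))) : (Λ → (sphere (0 : EuclideanSpace ℝ m) 1)) × (Λ → (EuclideanSpace ℝ m)) :=
  (z.1, z.2 + δ • F z.1)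

omit [DecidableEq m] in
/-- **The lattice kick preserves `μ ⊗ Lebesgue^Λ`** for every s-finite configuration law `μ`
(translation of the momentum fibre; Fubini). -/
theorem measurePreserving_latticeKick {F : (Λ → (sphere (0 : EuclideanSpace ℝ m) 1)) → (Λ → (EuclideanSpace ℝ m))} (hF : Measurable F) (δ : ℝ)
    (μ : Measure (Λ → (sphere (0 : EuclideanSpace ℝ m) 1))) [SFinite μ] :
    MeasurePreserving (latticeKick F δ) (μ.prod (Measure.pi fun _ : Λ => (volume : Measure (EuclideanSpace ℝ m))))
      (μ.prod (Measure.pi fun _ : Λ => (volume : Measure (EuclideanSpace ℝ m)))) := by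
  have hg : Measurable (Function.uncurry fun (x : Λ → (sphere (0 : EuclideanSpace ℝ m) 1)) (p : Λ → (EuclideanSpace ℝ m)) => p + δ • F x) :=
    measurable_snd.add ((hF.comp measurable_fst).const_smul δ)
  exact (MeasurePreserving.id μ).skew_product (g := fun (x : Λ → (sphere (0 : EuclideanSpace ℝ m) 1)) (p : Λ → (EuclideanSpace ℝ m)) => p + δ • F x) hg
    (ae_of_all _ fun x =>
      (measurePreserving_add_right (Measure.pi fun _ : Λ => (volume : Measure (EuclideanSpace ℝ m))) (δ • F x)).map_eq)

/-- The lattice momentum flip (sitewise). -/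
def latticeFlip (z : (Λ → (sphere (0 : EuclideanSpace ℝ m) 1)) × (Λ → (EuclideanSpace ℝ m))) : (Λ → (sphere (0 : EuclideanSpace ℝ m) 1)) × (Λ → (EuclideanSpace ℝ m)) := (z.1, -z.2)

omit [DecidableEq m] [Fintype Λ] in
/-- The lattice flip is `sitewise ambientFlip`. -/
theorem latticeFlip_eq_sitewise :
    (latticeFlip : (Λ → (sphere (0 : EuclideanSpace ℝ m) 1)) × (Λ → (EuclideanSpace ℝ m)) → (Λ → (sphere (0 : EuclideanSpace ℝ m) 1)) × (Λ → (EuclideanSpace ℝ m))) = sitewise ambientFlip := rfl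

omit [DecidableEq m] [Fintype Λ] in
/-- The lattice flip is an involution. -/
@[simp] theorem latticeFlip_latticeFlip (z : (Λ → (sphere (0 : EuclideanSpace ℝ m) 1)) × (Λ → (EuclideanSpace ℝ m))) : latticeFlip (latticeFlip z) = z := by
  simp [latticeFlip]

/-- The lattice geodesic DRIFT: E–S eq. (11) at every site (ambient momenta, normal components carried). -/
def latticeDrift (t : ℝ) : (Λ → (sphere (0 : EuclideanSpace ℝ m) 1)) × (Λ → (EuclideanSpace ℝ m)) → (Λ → (sphere (0 : EuclideanSpace ℝ m) 1)) × (Λ → (EuclideanSpace ℝ m)) := sitewise (ambientDrift t)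

omit [DecidableEq m] [Fintype Λ] in
/-- Time reversal of the lattice drift (sitewise). -/
theorem latticeDrift_flip_latticeDrift (t : ℝ) (z : (Λ → (sphere (0 : EuclideanSpace ℝ m) 1)) × (Λ → (EuclideanSpace ℝ m))) :
    latticeDrift t (latticeFlip (latticeDrift t z)) = latticeFlip z := by
  rw [latticeFlip_eq_sitewise, latticeDrift, ← Function.comp_apply (f := sitewise (ambientDrift t)),
    ← Function.comp_apply (f := sitewise (ambientDrift t) ∘ sitewise ambientFlip), ← sitewise_comp,
    ← sitewise_comp]
  have h : (ambientDrift t ∘ ambientFlip) ∘ ambientDrift t = (ambientFlip : (sphere (0 : EuclideanSpace ℝ m) 1) × (EuclideanSpace ℝ m) → (sphere (0 : EuclideanSpace ℝ m) 1) × (EuclideanSpace ℝ m)) :=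
    funext fun w => ambientDrift_flip_ambientDrift t w
  rw [h]

/-- The lattice kick as a permutation. -/
def latticeKickPerm (F : (Λ → (sphere (0 : EuclideanSpace ℝ m) 1)) → (Λ → (EuclideanSpace ℝ m))) (δ : ℝ) : Equiv.Perm ((Λ → (sphere (0 : EuclideanSpace ℝ m) 1)) × (Λ → (EuclideanSpace ℝ m))) where
  toFun := latticeKick F δ
  invFun := latticeKick F (-δ)
  left_inv z := by simp [latticeKick]
  right_inv z := by simp [latticeKick]

/-- The lattice flip as a permutation. -/
def latticeFlipPerm : Equiv.Perm ((Λ → (sphere (0 : EuclideanSpace ℝ m) 1)) × (Λ → (EuclideanSpace ℝ m))) where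
  toFun := latticeFlip
  invFun := latticeFlip
  left_inv := latticeFlip_latticeFlip
  right_inv := latticeFlip_latticeFlip

omit [DecidableEq m] [Fintype Λ] in
/-- The lattice flip is an involution (as a permutation). -/
theorem latticeFlipPerm_mul_self :
    (latticeFlipPerm : Equiv.Perm ((Λ → (sphere (0 : EuclideanSpace ℝ m) 1)) × (Λ → (EuclideanSpace ℝ m)))) * latticeFlipPerm = 1 := by
  ext z : 1
  exact latticeFlip_latticeFlip z

/-- The lattice drift as a permutation (inverse: flip, drift, flip). -/
def latticeDriftPerm (t : ℝ) : Equiv.Perm ((Λ → (sphere (0 : EuclideanSpace ℝ m) 1)) × (Λ → (EuclideanSpace ℝ m))) where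
  toFun := latticeDrift t
  invFun z := latticeFlip (latticeDrift t (latticeFlip z))
  left_inv z := by
    change latticeFlip (latticeDrift t (latticeFlip (latticeDrift t z))) = z
    rw [latticeDrift_flip_latticeDrift, latticeFlip_latticeFlip]
  right_inv z := by
    change latticeDrift t (latticeFlip (latticeDrift t (latticeFlip z))) = z
    rw [latticeDrift_flip_latticeDrift, latticeFlip_latticeFlip]

omit [DecidableEq m] [Fintype Λ] in
/-- The lattice kick is time-reversible (any force). -/
theorem latticeKickPerm_isFlipReversible (F : (Λ → (sphere (0 : EuclideanSpace ℝ m) 1)) → (Λ → (EuclideanSpace ℝ m))) (δ : ℝ) :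
    IsFlipReversible (latticeFlipPerm : Equiv.Perm ((Λ → (sphere (0 : EuclideanSpace ℝ m) 1)) × (Λ → (EuclideanSpace ℝ m)))) (latticeKickPerm F δ) := by
  ext z : 1
  change latticeFlip (latticeKick F δ (latticeFlip z)) = latticeKick F (-δ) z
  refine Prod.ext rfl ?_
  simp only [latticeFlip, latticeKick, neg_add, neg_neg, neg_smul]

omit [DecidableEq m] [Fintype Λ] in
/-- The lattice drift is time-reversible. -/
theorem latticeDriftPerm_isFlipReversible (t : ℝ) :
    IsFlipReversible (latticeFlipPerm : Equiv.Perm ((Λ → (sphere (0 : EuclideanSpace ℝ m) 1)) × (Λ → (EuclideanSpace ℝ m)))) (latticeDriftPerm t) := by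
  ext z : 1
  rfl

/-- **The lattice leapfrog of E–S §2.2**: half kick (site-coupling force), sitewise exact geodesic
drift, half kick. -/
def latticeLeapfrogPerm (F : (Λ → (sphere (0 : EuclideanSpace ℝ m) 1)) → (Λ → (EuclideanSpace ℝ m))) (δ : ℝ) : Equiv.Perm ((Λ → (sphere (0 : EuclideanSpace ℝ m) 1)) × (Λ → (EuclideanSpace ℝ m))) :=
  latticeKickPerm F (δ / 2) * latticeDriftPerm δ * latticeKickPerm F (δ / 2)

omit [DecidableEq m] [Fintype Λ] in
/-- **The lattice proposal — trajectory then flip — is an involution** (every force, step, length). -/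
theorem involutive_latticeProposal (F : (Λ → (sphere (0 : EuclideanSpace ℝ m) 1)) → (Λ → (EuclideanSpace ℝ m))) (δ : ℝ) (n : ℕ) :
    Function.Involutive
      ⇑((latticeFlipPerm : Equiv.Perm ((Λ → (sphere (0 : EuclideanSpace ℝ m) 1)) × (Λ → (EuclideanSpace ℝ m)))) * latticeLeapfrogPerm F δ ^ n) :=
  (((latticeKickPerm_isFlipReversible F (δ / 2)).palindrome (latticeDriftPerm_isFlipReversible δ)
    latticeFlipPerm_mul_self).pow latticeFlipPerm_mul_self n).involutive

variable [Nonempty m]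

/-- **Liouville for the lattice leapfrog**: the proposal preserves `uniformSphere^Λ ⊗ Lebesgue^Λ`. -/
theorem measurePreserving_latticeProposal (h2 : 2 ≤ Fintype.card m) {F : (Λ → (sphere (0 : EuclideanSpace ℝ m) 1)) → (Λ → (EuclideanSpace ℝ m))}
    (hF : Measurable F) (δ : ℝ) (n : ℕ) :
    MeasurePreserving
      ⇑((latticeFlipPerm : Equiv.Perm ((Λ → (sphere (0 : EuclideanSpace ℝ m) 1)) × (Λ → (EuclideanSpace ℝ m)))) * latticeLeapfrogPerm F δ ^ n)
      ((Measure.pi fun _ : Λ => uniformSphere (volume : Measure (EuclideanSpace ℝ m))).prod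
        (Measure.pi fun _ : Λ => (volume : Measure (EuclideanSpace ℝ m))))
      ((Measure.pi fun _ : Λ => uniformSphere (volume : Measure (EuclideanSpace ℝ m))).prod
        (Measure.pi fun _ : Λ => (volume : Measure (EuclideanSpace ℝ m)))) := by
  have hK := measurePreserving_latticeKick hF (δ / 2)
    (Measure.pi fun _ : Λ => uniformSphere (volume : Measure (EuclideanSpace ℝ m)))
  have hD : MeasurePreserving (latticeDrift (Λ := Λ) δ)
      ((Measure.pi fun _ : Λ => uniformSphere (volume : Measure (EuclideanSpace ℝ m))).prod
        (Measure.pi fun _ : Λ => (volume : Measure (EuclideanSpace ℝ m))))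
      ((Measure.pi fun _ : Λ => uniformSphere (volume : Measure (EuclideanSpace ℝ m))).prod
        (Measure.pi fun _ : Λ => (volume : Measure (EuclideanSpace ℝ m)))) :=
    measurePreserving_sitewise (measurePreserving_ambientDrift h2 δ (sphereDefault : (sphere (0 : EuclideanSpace ℝ m) 1)))
  have hR : MeasurePreserving (latticeFlip (Λ := Λ) (m := m))
      ((Measure.pi fun _ : Λ => uniformSphere (volume : Measure (EuclideanSpace ℝ m))).prod
        (Measure.pi fun _ : Λ => (volume : Measure (EuclideanSpace ℝ m))))
      ((Measure.pi fun _ : Λ => uniformSphere (volume : Measure (EuclideanSpace ℝ m))).prod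
        (Measure.pi fun _ : Λ => (volume : Measure (EuclideanSpace ℝ m)))) := by
    rw [latticeFlip_eq_sitewise]
    exact measurePreserving_sitewise (measurePreserving_ambientFlip _)
  have hL : MeasurePreserving ⇑(latticeLeapfrogPerm F δ)
      ((Measure.pi fun _ : Λ => uniformSphere (volume : Measure (EuclideanSpace ℝ m))).prod
        (Measure.pi fun _ : Λ => (volume : Measure (EuclideanSpace ℝ m))))
      ((Measure.pi fun _ : Λ => uniformSphere (volume : Measure (EuclideanSpace ℝ m))).prod
        (Measure.pi fun _ : Λ => (volume : Measure (EuclideanSpace ℝ m)))) := by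
    rw [latticeLeapfrogPerm, Equiv.Perm.coe_mul, Equiv.Perm.coe_mul]
    exact (hK.comp hD).comp hK
  rw [Equiv.Perm.coe_mul]
  exact hR.comp (measurePreserving_perm_pow hL n)

/-- **HMC ON A LATTICE OF SITE SPHERES IS EXACT** (the CP(N−1)/O(N) molecular dynamics of E–S §2.2,
sphere factors; site-coupling force `F` arbitrary measurable).  Target `e^{−S}·σ^Λ`; momenta
`Z⁻¹e^{−T}·Lebesgue^Λ`; proposal = `n` lattice-leapfrog steps then the flip; Metropolis with
`H = S + T`; forget the momenta: `e^{−S}·σ^Λ` is invariant. -/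
theorem lattice_sphere_hmc_config_exact (h2 : 2 ≤ Fintype.card m) {S : (Λ → (sphere (0 : EuclideanSpace ℝ m) 1)) → ℝ}
    (hS : Measurable S) {T : (Λ → (EuclideanSpace ℝ m)) → ℝ} (hT : Measurable T) {F : (Λ → (sphere (0 : EuclideanSpace ℝ m) 1)) → (Λ → (EuclideanSpace ℝ m))}
    (hF : Measurable F) (δ : ℝ) (n : ℕ)
    (hZ0 : (Measure.pi fun _ : Λ => (volume : Measure (EuclideanSpace ℝ m))).withDensity
      (fun p => ENNReal.ofReal (Real.exp (-T p))) Set.univ ≠ 0)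
    (hZtop : (Measure.pi fun _ : Λ => (volume : Measure (EuclideanSpace ℝ m))).withDensity
      (fun p => ENNReal.ofReal (Real.exp (-T p))) Set.univ ≠ ⊤) :
    ProbabilityTheory.Kernel.Invariant
      (refreshUpdate
        (involMH ⇑((latticeFlipPerm : Equiv.Perm ((Λ → (sphere (0 : EuclideanSpace ℝ m) 1)) × (Λ → (EuclideanSpace ℝ m)))) * latticeLeapfrogPerm F δ ^ n)
          (measurePreserving_latticeProposal h2 hF δ n).measurable
          fun z : (Λ → (sphere (0 : EuclideanSpace ℝ m) 1)) × (Λ → (EuclideanSpace ℝ m)) => S z.1 + T z.2)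
        (((Measure.pi fun _ : Λ => (volume : Measure (EuclideanSpace ℝ m))).withDensity
            (fun p => ENNReal.ofReal (Real.exp (-T p))) Set.univ)⁻¹ •
          (Measure.pi fun _ : Λ => (volume : Measure (EuclideanSpace ℝ m))).withDensity
            fun p => ENNReal.ofReal (Real.exp (-T p))))
      ((Measure.pi fun _ : Λ => uniformSphere (volume : Measure (EuclideanSpace ℝ m))).withDensity
        fun x => ENNReal.ofReal (Real.exp (-S x))) :=
  hmc_config_exact hS hT (involutive_latticeProposal F δ n) (measurePreserving_latticeProposal h2 hF δ n)
    hZ0 hZtop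

/-- **THMC ON A LATTICE OF SITE SPHERES IS EXACT**: the same through a field transformation `Φ` of
the lattice configuration space with positive Jacobian for `σ^Λ` (e.g. the E–S checkerboard sweep
of LO site kicks, `SphereKickSweep.lean`), momenta integrated for the pulled-back action and the
state reported through `Φ`. -/
theorem lattice_sphere_thmc_config_exact (h2 : 2 ≤ Fintype.card m) {Φ : (Λ → (sphere (0 : EuclideanSpace ℝ m) 1)) ≃ᵐ (Λ → (sphere (0 : EuclideanSpace ℝ m) 1))}
    {J : (Λ → (sphere (0 : EuclideanSpace ℝ m) 1)) → ℝ} (hJ : ∀ x, 0 < J x) (hJm : Measurable J)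
    (hΦ : HasJacobian (Measure.pi fun _ : Λ => uniformSphere (volume : Measure (EuclideanSpace ℝ m))) Φ
      fun x => ENNReal.ofReal (J x))
    {S : (Λ → (sphere (0 : EuclideanSpace ℝ m) 1)) → ℝ} (hS : Measurable S) {T : (Λ → (EuclideanSpace ℝ m)) → ℝ} (hT : Measurable T)
    {F : (Λ → (sphere (0 : EuclideanSpace ℝ m) 1)) → (Λ → (EuclideanSpace ℝ m))} (hF : Measurable F) (δ : ℝ) (n : ℕ)
    (hZ0 : (Measure.pi fun _ : Λ => (volume : Measure (EuclideanSpace ℝ m))).withDensity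
      (fun p => ENNReal.ofReal (Real.exp (-T p))) Set.univ ≠ 0)
    (hZtop : (Measure.pi fun _ : Λ => (volume : Measure (EuclideanSpace ℝ m))).withDensity
      (fun p => ENNReal.ofReal (Real.exp (-T p))) Set.univ ≠ ⊤) :
    ProbabilityTheory.Kernel.Invariant
      (conjKernel
        (refreshUpdate
          (involMH ⇑((latticeFlipPerm : Equiv.Perm ((Λ → (sphere (0 : EuclideanSpace ℝ m) 1)) × (Λ → (EuclideanSpace ℝ m)))) * latticeLeapfrogPerm F δ ^ n)
            (measurePreserving_latticeProposal h2 hF δ n).measurable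
            fun z : (Λ → (sphere (0 : EuclideanSpace ℝ m) 1)) × (Λ → (EuclideanSpace ℝ m)) => (S (Φ z.1) - Real.log (J z.1)) + T z.2)
          (((Measure.pi fun _ : Λ => (volume : Measure (EuclideanSpace ℝ m))).withDensity
              (fun p => ENNReal.ofReal (Real.exp (-T p))) Set.univ)⁻¹ •
            (Measure.pi fun _ : Λ => (volume : Measure (EuclideanSpace ℝ m))).withDensity
              fun p => ENNReal.ofReal (Real.exp (-T p))))
        Φ)
      ((Measure.pi fun _ : Λ => uniformSphere (volume : Measure (EuclideanSpace ℝ m))).withDensity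
        fun x => ENNReal.ofReal (Real.exp (-S x))) :=
  thmc_config_exact hJ hJm hΦ hS hT (involutive_latticeProposal F δ n)
    (measurePreserving_latticeProposal h2 hF δ n) hZ0 hZtop


/-! ### The Gaussian kinetic energy `T = Σ_s ‖p_s‖²/2` -/

omit [DecidableEq m] [Nonempty m] in
/-- The product Gaussian momentum weight has a finite, non-zero normalisation on `(ℝ^d)^Λ`
(Tonelli: the product of the one-site Gaussian integrals). -/
theorem latticeGaussianWeight_univ_ne_zero_ne_top :
    (Measure.pi fun _ : Λ => (volume : Measure (EuclideanSpace ℝ m))).withDensity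
        (fun p => ENNReal.ofReal (Real.exp (-(∑ s, ‖p s‖ ^ 2 / 2)))) Set.univ ≠ 0 ∧
    (Measure.pi fun _ : Λ => (volume : Measure (EuclideanSpace ℝ m))).withDensity
        (fun p => ENNReal.ofReal (Real.exp (-(∑ s, ‖p s‖ ^ 2 / 2)))) Set.univ ≠ ⊤ := by
  have hmeas1 : Measurable fun q : EuclideanSpace ℝ m => ENNReal.ofReal (Real.exp (-(‖q‖ ^ 2 / 2))) :=
    (Real.measurable_exp.comp (measurable_norm.pow_const 2 |>.div_const 2).neg).ennreal_ofReal
  have h1 : ∀ p : Λ → EuclideanSpace ℝ m, ENNReal.ofReal (Real.exp (-(∑ s, ‖p s‖ ^ 2 / 2))) =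
      ∏ s, ENNReal.ofReal (Real.exp (-(‖p s‖ ^ 2 / 2))) := by
    intro p
    rw [← ENNReal.ofReal_prod_of_nonneg (fun s _ => (Real.exp_pos _).le), ← Real.exp_sum,
      ← Finset.sum_neg_distrib]
  rw [withDensity_apply _ MeasurableSet.univ, Measure.restrict_univ]
  simp_rw [h1]
  rw [lintegral_prod_pi (fun _ : Λ => (volume : Measure (EuclideanSpace ℝ m))) (fun _ => hmeas1)]
  -- the one-site factor
  have hZ0 : (∫⁻ q : EuclideanSpace ℝ m, ENNReal.ofReal (Real.exp (-(‖q‖ ^ 2 / 2)))) ≠ 0 := by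
    intro h0
    rw [lintegral_eq_zero_iff hmeas1] at h0
    have h1 : (volume : Measure (EuclideanSpace ℝ m))
        {q | ENNReal.ofReal (Real.exp (-(‖q‖ ^ 2 / 2))) ≠ 0} = 0 := by
      have := h0
      rw [Filter.EventuallyEq, ae_iff] at this
      simpa using this
    have huniv : {q : EuclideanSpace ℝ m | ENNReal.ofReal (Real.exp (-(‖q‖ ^ 2 / 2))) ≠ 0} = Set.univ := by
      refine Set.eq_univ_of_forall fun q => ?_
      rw [Set.mem_setOf_eq, Ne, ENNReal.ofReal_eq_zero, not_le]
      exact Real.exp_pos _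
    rw [huniv] at h1
    exact isOpen_univ.measure_ne_zero (volume : Measure (EuclideanSpace ℝ m)) Set.univ_nonempty h1
  have hZtop : (∫⁻ q : EuclideanSpace ℝ m, ENNReal.ofReal (Real.exp (-(‖q‖ ^ 2 / 2)))) ≠ ⊤ := by
    have hint : Integrable (fun q : EuclideanSpace ℝ m => Real.exp (-(‖q‖ ^ 2 / 2)))
        (volume : Measure (EuclideanSpace ℝ m)) := by
      have h := GaussianFourier.integral_rexp_neg_mul_sq_norm (V := EuclideanSpace ℝ m) (b := 1 / 2)
        (by norm_num)
      have hfun : (fun q : EuclideanSpace ℝ m => Real.exp (-(1 / 2) * ‖q‖ ^ 2)) =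
          fun q => Real.exp (-(‖q‖ ^ 2 / 2)) := by
        funext q; congr 1; ring
      rw [hfun] at h
      by_contra hni
      rw [integral_undef hni] at h
      have hpos : 0 < (Real.pi / (1 / 2)) ^ ((Module.finrank ℝ (EuclideanSpace ℝ m) : ℝ) / 2) := by
        positivity
      exact hpos.ne h
    exact (hint.lintegral_lt_top).ne
  exact ⟨Finset.prod_ne_zero_iff.2 fun s _ => hZ0, ENNReal.prod_ne_top fun s _ => hZtop⟩

/-- **HMC on the lattice of site spheres with Gaussian momenta is exact** (`T = Σ_s ‖p_s‖²/2`, the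
E–S choice; for a sitewise-tangent force the normal components are inert). -/
theorem lattice_sphere_hmc_gaussian_exact (h2 : 2 ≤ Fintype.card m) {S : (Λ → (sphere (0 : EuclideanSpace ℝ m) 1)) → ℝ}
    (hS : Measurable S) {F : (Λ → (sphere (0 : EuclideanSpace ℝ m) 1)) → (Λ → (EuclideanSpace ℝ m))}
    (hF : Measurable F) (δ : ℝ) (n : ℕ) :
    ProbabilityTheory.Kernel.Invariant
      (refreshUpdate
        (involMH ⇑((latticeFlipPerm : Equiv.Perm ((Λ → (sphere (0 : EuclideanSpace ℝ m) 1)) × (Λ → (EuclideanSpace ℝ m)))) * latticeLeapfrogPerm F δ ^ n)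
          (measurePreserving_latticeProposal h2 hF δ n).measurable
          fun z : (Λ → (sphere (0 : EuclideanSpace ℝ m) 1)) × (Λ → (EuclideanSpace ℝ m)) => S z.1 + ∑ s, ‖z.2 s‖ ^ 2 / 2)
        (((Measure.pi fun _ : Λ => (volume : Measure (EuclideanSpace ℝ m))).withDensity
            (fun p => ENNReal.ofReal (Real.exp (-(∑ s, ‖p s‖ ^ 2 / 2)))) Set.univ)⁻¹ •
          (Measure.pi fun _ : Λ => (volume : Measure (EuclideanSpace ℝ m))).withDensity
            fun p => ENNReal.ofReal (Real.exp (-(∑ s, ‖p s‖ ^ 2 / 2)))))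
      ((Measure.pi fun _ : Λ => uniformSphere (volume : Measure (EuclideanSpace ℝ m))).withDensity
        fun x => ENNReal.ofReal (Real.exp (-S x))) := by
  have hT : Measurable fun p : Λ → EuclideanSpace ℝ m => ∑ s, ‖p s‖ ^ 2 / 2 :=
    (continuous_finsetSum _ fun s _ => (((continuous_apply s).norm).pow 2).div_const 2).measurable
  exact lattice_sphere_hmc_config_exact h2 hS hT hF δ n latticeGaussianWeight_univ_ne_zero_ne_top.1
    latticeGaussianWeight_univ_ne_zero_ne_top.2

end Lattice

end Summit.Ventures.LatticeQCDFlow.Exactness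

end
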